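import Summits.NavierStokesRegularity.NavierStokesRegularity.Theses.RellichScar
import Literature.Analysis.FluidPDE.AxisymmetricReflection

/-!
# Crux `SymmetricScarExists` (stmt-NavierStokesRegularity-11718), line `rdss-screw-split` — stub
# `stub_rotationNormalForm` (AUX-4): Euler's rotation theorem as a normal form

Helper file of the line lead (`--supports stmt-NavierStokesRegularity-11718`; theorems only, no
definitions, no named facts), pure linear algebra on `ℝ³ = EuclideanSpace ℝ (Fin 3)`.
Every linear isometry `R` of `ℝ³` with `det R > 0` is conjugate by a linear isometry `Q` to a
rotation `rotZ θ` about the `x₂`-axis: `R x = Q (rotZ θ (Q⁻¹ x))` (`stub_rotationNormalForm`); it is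
used (AUX-5) to move a screw symmetry about an arbitrary axis to the `e₂`-axis.

Proof.  (1) In standard coordinates `R` is an orthogonal matrix `M` (`Mᵀ M = 1`,
`rotNF_exists_matrix`) with `det M = det R > 0`; from `Mᵀ (M − 1) = (−(M − 1))ᵀ` and
`det (−A) = −det A` in odd dimension, `det M · det (M − 1) = −det (M − 1)`, so `det (M − 1) = 0` and
`M` has a non-zero fixed vector (`Matrix.exists_mulVec_eq_zero_iff`), normalised to a unit vector
`n` with `R n = n` (`rotNF_exists_fixed_unit`).  (2) The Householder reflection `Q` in the
hyperplane orthogonal to `e₂ − n` is a linear isometry with `Q e₂ = n` (`Submodule.reflection_sub`).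
(3) `S := Q⁻¹ R Q` is a linear isometry fixing `e₂` with `det S = det R > 0`
(`LinearMap.det_conj`); its matrix `N` is orthogonal with third column `e₂`, hence third row `e₂`,
the upper `2 × 2` block `(a c; b d)` has orthonormal columns and `det S = ad − bc`, so
`(ad − bc)² = 1`, `ad − bc = 1`, `(c, d) = (−b, a)`; with `cos θ = a`, `sin θ = b`
(`Literature.Analysis.FluidPDE.exists_cos_eq_sin_eq`) `S = rotZ θ` coordinate-wise
(`rotNF_eq_rotZ_of_map_single_two`); finally
`R x = Q (S (Q⁻¹ x)) = Q (rotZ θ (Q⁻¹ x))`.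

## References

* L. Euler, *Formulae generales pro translatione quacunque corporum rigidorum*, Novi Comment.
  Acad. Sci. Petropolitanae 20 (1776), 189–207 (Euler's rotation theorem: every proper rotation of
  `ℝ³` has an axis). [folklore]
* M. Artin, *Algebra*, the section on orthogonal matrices and rotations of `ℝ³` (Euler's theorem:
  `SO₃` consists of the rotations about axes through the origin). [folklore]
-/

noncomputable section

open MeasureTheory Set Function Filter Topology TopologicalSpace Metric
open scoped NNReal ENNReal

namespace Summit.NavierStokesRegularity.NavierStokesRegularity.Theorems.SymmetricScarExists.RdssSplit.AnyAxis
set_option linter.dupNamespace false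

open Literature.Analysis.FluidPDE WithLp
open scoped InnerProductSpace RealInnerProductSpace Matrix

/-! ### A coordinate matrix of a linear isometry of `ℝ³` -/

/-- The dot product of standard coordinates is the Euclidean inner product of `ℝ³`. [folklore] -/
theorem rotNF_dotProduct_ofLp (x y : EuclideanSpace ℝ (Fin 3)) : ofLp x ⬝ᵥ ofLp y = ⟪x, y⟫_ℝ := by
  simp [EuclideanSpace.inner_eq_star_dotProduct, dotProduct_comm]

/-- A matrix representing a linear isometry of `ℝ³` in standard coordinates preserves the dot
product. [folklore] -/
theorem rotNF_repr_mulVec_dotProduct {T : EuclideanSpace ℝ (Fin 3) ≃ₗᵢ[ℝ] EuclideanSpace ℝ (Fin 3)}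
    {M : Matrix (Fin 3) (Fin 3) ℝ} (hM : ∀ x : EuclideanSpace ℝ (Fin 3), M *ᵥ ofLp x = ofLp (T x))
    (u w : Fin 3 → ℝ) : (M *ᵥ u) ⬝ᵥ (M *ᵥ w) = u ⬝ᵥ w := by
  have hu : u = ofLp (toLp 2 u) := rfl
  have hw : w = ofLp (toLp 2 w) := rfl
  rw [hu, hw, hM, hM, rotNF_dotProduct_ofLp, rotNF_dotProduct_ofLp,
    LinearIsometryEquiv.inner_map_map]

/-- A matrix representing a linear isometry of `ℝ³` in standard coordinates is orthogonal:
`Mᵀ M = 1`. [folklore] -/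
theorem rotNF_repr_transpose_mul_self
    {T : EuclideanSpace ℝ (Fin 3) ≃ₗᵢ[ℝ] EuclideanSpace ℝ (Fin 3)} {M : Matrix (Fin 3) (Fin 3) ℝ}
    (hM : ∀ x : EuclideanSpace ℝ (Fin 3), M *ᵥ ofLp x = ofLp (T x)) : Mᵀ * M = 1 := by
  ext i j
  have h := rotNF_repr_mulVec_dotProduct hM (Pi.single i 1) (Pi.single j 1)
  rw [Matrix.mulVec_single_one, Matrix.mulVec_single_one, dotProduct_comm] at h
  simp only [single_dotProduct, one_mul] at h
  rw [Matrix.mul_apply]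
  simp only [Matrix.transpose_apply]
  rw [show (∑ k, M k i * M k j) = (fun k => M k j) ⬝ᵥ (fun k => M k i) by
    simp [dotProduct, mul_comm]]
  change M.col j ⬝ᵥ M.col i = _ at h ⊢
  · simpa [Matrix.one_apply, Pi.single_apply, eq_comm] using h

/-- **Coordinate matrix of a linear isometry of `ℝ³`.** Every linear isometry `T` of
`ℝ³ = EuclideanSpace ℝ (Fin 3)` is represented in standard coordinates by an orthogonal matrix `M`
(`M (ofLp x) = ofLp (T x)`, entries `M i j = (T e_j) i`, `Mᵀ M = 1`) whose determinant is the
determinant of `T`. [folklore] -/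
theorem rotNF_exists_matrix (T : EuclideanSpace ℝ (Fin 3) ≃ₗᵢ[ℝ] EuclideanSpace ℝ (Fin 3)) :
    ∃ M : Matrix (Fin 3) (Fin 3) ℝ,
      M.det = LinearMap.det (T.toLinearEquiv : EuclideanSpace ℝ (Fin 3) →ₗ[ℝ] EuclideanSpace ℝ (Fin 3)) ∧
      (∀ x : EuclideanSpace ℝ (Fin 3), M *ᵥ ofLp x = ofLp (T x)) ∧
      (∀ i j : Fin 3, M i j = T (EuclideanSpace.single j 1) i) ∧ Mᵀ * M = 1 := by
  set e := WithLp.linearEquiv 2 ℝ (Fin 3 → ℝ)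
  set M : Matrix (Fin 3) (Fin 3) ℝ := LinearMap.toMatrix'
    ((e : EuclideanSpace ℝ (Fin 3) →ₗ[ℝ] (Fin 3 → ℝ)) ∘ₗ
      (T.toLinearEquiv : EuclideanSpace ℝ (Fin 3) →ₗ[ℝ] EuclideanSpace ℝ (Fin 3)) ∘ₗ
      (e.symm : (Fin 3 → ℝ) →ₗ[ℝ] EuclideanSpace ℝ (Fin 3))) with hM
  have happly : ∀ x : EuclideanSpace ℝ (Fin 3), M *ᵥ ofLp x = ofLp (T x) := fun x => by
    rw [hM, LinearMap.toMatrix'_mulVec]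
    rfl
  have hentry : ∀ i j : Fin 3, M i j = T (EuclideanSpace.single j 1) i := fun i j => by
    have h := congrFun (happly (EuclideanSpace.single j 1)) i
    rw [show ofLp (EuclideanSpace.single j (1 : ℝ)) = Pi.single j 1 from rfl,
      Matrix.mulVec_single_one] at h
    exact h
  refine ⟨M, ?_, happly, hentry, rotNF_repr_transpose_mul_self happly⟩
  rw [hM, LinearMap.det_toMatrix', LinearMap.det_conj]

/-! ### A fixed unit vector (Euler's rotation theorem) -/

/-- **Euler's rotation theorem (existence of the axis).** A linear isometry `R` of `ℝ³` with
`det R > 0` has a unit fixed vector: in coordinates `Mᵀ (M − 1) = (−(M − 1))ᵀ` gives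
`det M · det (M − 1) = (−1)³ det (M − 1)`, so `det (M − 1) = 0` as `det M > 0`, and the kernel of
`M − 1` contains a non-zero vector. [folklore] -/
theorem rotNF_exists_fixed_unit (R : EuclideanSpace ℝ (Fin 3) ≃ₗᵢ[ℝ] EuclideanSpace ℝ (Fin 3))
    (hR : 0 < LinearMap.det
      (R.toLinearEquiv : EuclideanSpace ℝ (Fin 3) →ₗ[ℝ] EuclideanSpace ℝ (Fin 3))) :
    ∃ n : EuclideanSpace ℝ (Fin 3), ‖n‖ = 1 ∧ R n = n := by
  obtain ⟨M, hdet, hM, -, hMM⟩ := rotNF_exists_matrix R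
  have h1 : Mᵀ * (M - 1) = (-(M - 1))ᵀ := by
    rw [Matrix.mul_sub, hMM, Matrix.mul_one, neg_sub, Matrix.transpose_sub, Matrix.transpose_one]
  have h2 : M.det * (M - 1).det = -(M - 1).det := by
    have h := congrArg Matrix.det h1
    rw [Matrix.det_mul, Matrix.det_transpose, Matrix.det_transpose, Matrix.det_neg,
      Fintype.card_fin] at h
    linear_combination h
  have h3 : (M - 1).det = 0 := by
    have hpos : 0 < M.det := by rw [hdet]; exact hR
    have h4 : (M - 1).det * (M.det + 1) = 0 := by linear_combination h2
    rcases mul_eq_zero.1 h4 with h | h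
    · exact h
    · exfalso
      linarith
  obtain ⟨w, hw0, hw⟩ := Matrix.exists_mulVec_eq_zero_iff.2 h3
  rw [Matrix.sub_mulVec, Matrix.one_mulVec, sub_eq_zero] at hw
  have hv : R (toLp 2 w) = toLp 2 w := by
    apply WithLp.ofLp_injective 2
    rw [← hM]
    exact hw
  have hv0 : (toLp 2 w : EuclideanSpace ℝ (Fin 3)) ≠ 0 := by
    intro h
    exact hw0 (by simpa using congrArg ofLp h)
  have hn0 : ‖(toLp 2 w : EuclideanSpace ℝ (Fin 3))‖ ≠ 0 := norm_ne_zero_iff.2 hv0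
  refine ⟨(‖(toLp 2 w : EuclideanSpace ℝ (Fin 3))‖⁻¹ : ℝ) • toLp 2 w, ?_, ?_⟩
  · rw [norm_smul, norm_inv, norm_norm, inv_mul_cancel₀ hn0]
  · rw [map_smul, hv]

/-! ### An isometry of positive determinant fixing `e₂` is a rotation about the `x₂`-axis -/

/-- **A linear isometry of `ℝ³` with positive determinant fixing `e₂` is a rotation `rotZ θ`.**
Its coordinate matrix `N` is orthogonal with third column `e₂`, hence third row `e₂`; the upper
`2 × 2` block `(a c; b d)` has orthonormal columns and determinant `det N > 0`, so by the Lagrange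
identity `(ad − bc)² = (a² + b²)(c² + d²) − (ac + bd)² = 1`, `ad − bc = 1` and `(c, d) = (−b, a)`;
with `cos θ = a`, `sin θ = b` the map is `rotZ θ` coordinate-wise. [folklore] -/
theorem rotNF_eq_rotZ_of_map_single_two
    (S : EuclideanSpace ℝ (Fin 3) ≃ₗᵢ[ℝ] EuclideanSpace ℝ (Fin 3))
    (hS : 0 < LinearMap.det
      (S.toLinearEquiv : EuclideanSpace ℝ (Fin 3) →ₗ[ℝ] EuclideanSpace ℝ (Fin 3)))
    (h2 : S (EuclideanSpace.single 2 1) = EuclideanSpace.single 2 1) :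
    ∃ θ : ℝ, ∀ x : EuclideanSpace ℝ (Fin 3), S x = rotZ θ x := by
  obtain ⟨N, hdet, hN, hNe, hNN⟩ := rotNF_exists_matrix S
  -- the third column of `N` is `e₂`
  have c02 : N 0 2 = 0 := by rw [hNe, h2]; simp
  have c12 : N 1 2 = 0 := by rw [hNe, h2]; simp
  have c22 : N 2 2 = 1 := by rw [hNe, h2]; simp
  -- orthonormality of the columns
  have o : ∀ i j : Fin 3, N 0 i * N 0 j + N 1 i * N 1 j + N 2 i * N 2 j
      = (1 : Matrix (Fin 3) (Fin 3) ℝ) i j := fun i j => by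
    have h := congrFun (congrFun hNN i) j
    simp only [Matrix.mul_apply, Fin.sum_univ_three, Matrix.transpose_apply] at h
    exact h
  -- the third row of `N` is `e₂`
  have r20 : N 2 0 = 0 := by
    have h := o 0 2
    rw [Matrix.one_apply_ne (show (0 : Fin 3) ≠ 2 by decide), c02, c12, c22] at h
    linarith
  have r21 : N 2 1 = 0 := by
    have h := o 1 2
    rw [Matrix.one_apply_ne (show (1 : Fin 3) ≠ 2 by decide), c02, c12, c22] at h
    linarith
  -- the upper `2 × 2` block has orthonormal columns and determinant `det S > 0`
  have q00 : N 0 0 ^ 2 + N 1 0 ^ 2 = 1 := by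
    have h := o 0 0
    rw [Matrix.one_apply_eq, r20] at h
    linear_combination h
  have q11 : N 0 1 ^ 2 + N 1 1 ^ 2 = 1 := by
    have h := o 1 1
    rw [Matrix.one_apply_eq, r21] at h
    linear_combination h
  have q01 : N 0 0 * N 0 1 + N 1 0 * N 1 1 = 0 := by
    have h := o 0 1
    rw [Matrix.one_apply_ne (show (0 : Fin 3) ≠ 1 by decide), r20, r21] at h
    linear_combination h
  have hdet3 : N.det = N 0 0 * N 1 1 - N 0 1 * N 1 0 := by
    rw [Matrix.det_fin_three, c02, c12, c22, r20, r21]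
    ring
  have hpos : 0 < N 0 0 * N 1 1 - N 0 1 * N 1 0 := by
    rw [← hdet3, hdet]
    exact hS
  have hsq : (N 0 0 * N 1 1 - N 0 1 * N 1 0) ^ 2 = 1 := by
    linear_combination (N 0 1 ^ 2 + N 1 1 ^ 2) * q00 + q11 - (N 0 0 * N 0 1 + N 1 0 * N 1 1) * q01
  have hone : N 0 0 * N 1 1 - N 0 1 * N 1 0 = 1 := by
    have h : (N 0 0 * N 1 1 - N 0 1 * N 1 0 - 1) * (N 0 0 * N 1 1 - N 0 1 * N 1 0 + 1) = 0 := by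
      linear_combination hsq
    rcases mul_eq_zero.1 h with h | h
    · linarith
    · exfalso
      linarith
  -- hence `(c, d) = (−b, a)`
  have hsum : (N 0 1 + N 1 0) ^ 2 + (N 1 1 - N 0 0) ^ 2 = 0 := by
    linear_combination q00 + q11 - 2 * hone
  have hc : N 0 1 = -N 1 0 := by
    nlinarith [sq_nonneg (N 0 1 + N 1 0), sq_nonneg (N 1 1 - N 0 0)]
  have hd : N 1 1 = N 0 0 := by
    nlinarith [sq_nonneg (N 0 1 + N 1 0), sq_nonneg (N 1 1 - N 0 0)]
  -- the angle
  obtain ⟨θ, hcos, hsin⟩ := exists_cos_eq_sin_eq q00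
  refine ⟨θ, fun x => ?_⟩
  have hx : ∀ i : Fin 3, S x i = N i 0 * x 0 + N i 1 * x 1 + N i 2 * x 2 := fun i => by
    have h := congrFun (hN x) i
    rw [← h]
    simp [Matrix.mulVec, dotProduct, Fin.sum_univ_three]
  ext i
  fin_cases i <;>
    simp only [Fin.zero_eta, Fin.isValue, Fin.mk_one, Fin.reduceFinMk, hx, rotZ_apply_zero,
      rotZ_apply_one, rotZ_apply_two, hcos, hsin, hc, hd, c02, c12, c22, r20, r21] <;>
    ring

/-! ### The normal form -/

/-- AUX-4 `stub_rotationNormalForm` — **Euler's rotation theorem as a normal form.** Every linear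
isometry `R` of `ℝ³` with `det R > 0` is conjugate by a linear isometry `Q` to a rotation about
the `x₂`-axis: `R x = Q (rotZ θ (Q⁻¹ x))`.  Take a unit fixed vector `n` of `R`
(`rotNF_exists_fixed_unit`), the Householder reflection `Q` with `Q e₂ = n`
(`Submodule.reflection_sub`), and `S := Q⁻¹ R Q`, a linear isometry fixing `e₂` with
`det S = det R > 0` (`LinearMap.det_conj`), which is `rotZ θ` by
`rotNF_eq_rotZ_of_map_single_two`. [folklore] -/
theorem stub_rotationNormalForm : ∀ R : EuclideanSpace ℝ (Fin 3) ≃ₗᵢ[ℝ] EuclideanSpace ℝ (Fin 3), 0 < LinearMap.det (R.toLinearEquiv : EuclideanSpace ℝ (Fin 3) →ₗ[ℝ] EuclideanSpace ℝ (Fin 3)) → ∃ (Q : EuclideanSpace ℝ (Fin 3) ≃ₗᵢ[ℝ] EuclideanSpace ℝ (Fin 3)) (θ : ℝ), ∀ x : EuclideanSpace ℝ (Fin 3), R x = Q (Literature.Analysis.FluidPDE.rotZ θ (Q.symm x)) := by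
  intro R hR
  obtain ⟨n, hn, hRn⟩ := rotNF_exists_fixed_unit R hR
  have he : ‖(EuclideanSpace.single 2 1 : EuclideanSpace ℝ (Fin 3))‖ = ‖n‖ := by
    rw [hn]
    simp
  -- the Householder reflection `Q` with `Q e₂ = n`
  set Q : EuclideanSpace ℝ (Fin 3) ≃ₗᵢ[ℝ] EuclideanSpace ℝ (Fin 3) :=
    Submodule.reflection (ℝ ∙ ((EuclideanSpace.single 2 1 : EuclideanSpace ℝ (Fin 3)) - n))ᗮ
    with hQdef
  have hQ : Q (EuclideanSpace.single 2 1) = n := Submodule.reflection_sub he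
  -- `S := Q⁻¹ R Q` fixes `e₂` and has `det S = det R > 0`
  set S : EuclideanSpace ℝ (Fin 3) ≃ₗᵢ[ℝ] EuclideanSpace ℝ (Fin 3) := (Q.trans R).trans Q.symm
    with hSdef
  have hS2 : S (EuclideanSpace.single 2 1) = EuclideanSpace.single 2 1 := by
    rw [hSdef, LinearIsometryEquiv.trans_apply, LinearIsometryEquiv.trans_apply, hQ, hRn, ← hQ,
      LinearIsometryEquiv.symm_apply_apply]
  have hSdet : 0 < LinearMap.det
      (S.toLinearEquiv : EuclideanSpace ℝ (Fin 3) →ₗ[ℝ] EuclideanSpace ℝ (Fin 3)) := by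
    have hconj : (S.toLinearEquiv : EuclideanSpace ℝ (Fin 3) →ₗ[ℝ] EuclideanSpace ℝ (Fin 3)) =
        (Q.symm.toLinearEquiv : EuclideanSpace ℝ (Fin 3) →ₗ[ℝ] EuclideanSpace ℝ (Fin 3)) ∘ₗ
          (R.toLinearEquiv : EuclideanSpace ℝ (Fin 3) →ₗ[ℝ] EuclideanSpace ℝ (Fin 3)) ∘ₗ
          (Q.symm.toLinearEquiv.symm : EuclideanSpace ℝ (Fin 3) →ₗ[ℝ] EuclideanSpace ℝ (Fin 3)) :=
      LinearMap.ext fun _ => rfl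
    rw [hconj, LinearMap.det_conj]
    exact hR
  obtain ⟨θ, hθ⟩ := rotNF_eq_rotZ_of_map_single_two S hSdet hS2
  refine ⟨Q, θ, fun x => ?_⟩
  rw [← hθ (Q.symm x), hSdef, LinearIsometryEquiv.trans_apply, LinearIsometryEquiv.trans_apply,
    LinearIsometryEquiv.apply_symm_apply, LinearIsometryEquiv.apply_symm_apply]

end Summit.NavierStokesRegularity.NavierStokesRegularity.Theorems.SymmetricScarExists.RdssSplit.AnyAxis
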